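import Summits.Ventures.PercRepro.MSTightConjTSingleton
import Summits.Ventures.PercRepro.MSTightConjTSingCandidate

/-!
# Conjecture (T) through a second tightening direction

Dossier proofs/MINE1-theoremS.md, Addendum 47. Let `F` be twin-free with full support, `r` an
element with a tight trace, and `e ≠ r` a SECOND tightening direction (`proj e F` tight; Theorem
(TT) provides one for every twin-free excess-one family). The trace `proj e F` is tight and
twin-free at `r`, so by Theorem S (`dichotomy_of_tight`, `cls_eq_singleton`) `r` is removable or
addable for it: **orientation 10**, every `r`-member `t` has an `r`-free member `s` with
`s ∖ e = t ∖ e`, or **orientation 01**, the mirror (`orientation_of_tight_proj`).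

If moreover `e` lies in no partnerless `r`-member (orientation 10) or in every partnerless
`r`-free member (orientation 01), then `Y ⊆ X`: for `z = t ∖ s` with `t` partnerless, `e ∉ t`
forces `s' ⊇ t ⊇ z` for the `r`-free member `s'` with `s' ∖ e = t`, and the realisation lemma
`sdiff_mem_diffsX_of_superset_mem_part0` puts `z` into `X`; mirror with
`sdiff_mem_diffsX_of_disjoint_mem_partr` (`diffsY_subset_diffsX_of_orientation10/01`,
`diffsY_subset_diffsX_of_goodDirectionAt`).

The candidate Prop `GoodDirection α` (never asserted) records the census of Addendum 47: in a
residue instance at a genuine tight trace with at least two partnerless members on each side, such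
a direction exists (1,140 / 1,140 configurations; it fails only on singleton sides, which
MSTightConjTSingleton covers). `singNonMonotone_of_goodDirection_of_residue` assembles
`SingNonMonotone α` from `GoodDirection α` and `SingCaseIResidue α`, replacing `ConjT α` in the
lane's chain.
-/

namespace PercRepro.MSTight

open Finset
open scoped FinsetFamily

variable {α : Type*} [DecidableEq α] [Fintype α] {r e : α} {F : Finset (Finset α)}

section Orientation

omit [Fintype α] in
/-- A twin-free family with full support has a twin-free trace at every element (as a family on
`α`): two elements of `S'` are separated by a member, and `r` is separated from every `a ≠ r` by a
member containing `a`. -/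
theorem twinFree_proj_of_twinFree (htf : ∀ a b, Twin F a b → a = b)
    (hsupp : ∀ a, ∃ t ∈ F, a ∈ t) : ∀ a b, Twin (proj r F) a b → a = b := by
  have key : ∀ b, Twin (proj r F) r b → b = r := by
    intro b hb
    by_contra hbr
    obtain ⟨t', ht', hbt'⟩ := hsupp b
    have h := hb (t'.erase r) (mem_proj.2 ⟨t', ht', rfl⟩)
    have : b ∈ t'.erase r := mem_erase.2 ⟨hbr, hbt'⟩
    exact (mem_erase.1 (h.2 this)).1 rfl
  intro a b hab
  by_cases har : a = r
  · rw [har] at hab ⊢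
    exact (key b hab).symm
  · by_cases hbr : b = r
    · rw [hbr] at hab ⊢
      exact key a hab.symm
    · apply htf
      intro t ht
      have h := hab (t.erase r) (mem_proj.2 ⟨t, ht, rfl⟩)
      constructor
      · intro hat
        exact (mem_erase.1 (h.1 (mem_erase.2 ⟨har, hat⟩))).2
      · intro hbt
        exact (mem_erase.1 (h.2 (mem_erase.2 ⟨hbr, hbt⟩))).2

/-- **The orientation at `r` of a tight second trace.** If `proj e F` is tight (`e ≠ r`) and `F` is
twin-free with full support, then `r` is removable or addable for `proj e F`: every `r`-member `t`
has an `r`-free member `s` with `s ∖ e = t ∖ e` (orientation 10), or every `r`-free member `s` has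
an `r`-member `t` with `t ∖ e = s ∖ e` (orientation 01). -/
theorem orientation_of_tight_proj (hre : e ≠ r) (hG : Tight (proj e F))
    (htf : ∀ a b, Twin F a b → a = b) (hsupp : ∀ a, ∃ t ∈ F, a ∈ t) :
    (∀ t ∈ partr r F, ∃ s ∈ part0 r F, s.erase e = t.erase e) ∨
      (∀ s ∈ part0 r F, ∃ t ∈ partr r F, t.erase e = s.erase e) := by
  have hd := dichotomy_of_tight hG r
  have hcls : cls (proj e F) r = {r} :=
    cls_eq_singleton (fun x hx => (twinFree_proj_of_twinFree htf hsupp r x hx).symm)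
  rw [hcls] at hd
  rcases hd with h | h
  · -- `r` addable: orientation 01
    right
    intro s hs
    obtain ⟨hsF, hrs⟩ := mem_part0.1 hs
    have h2 := h _ (mem_proj.2 ⟨s, hsF, rfl⟩)
    obtain ⟨B, hB, hBe⟩ := mem_proj.1 h2
    have hrse : r ∉ s.erase e := fun h' => hrs (mem_erase.1 h').2
    have hBe' : B.erase e = insert r (s.erase e) := by
      rw [hBe, union_comm]; rfl
    have hrB : r ∈ B := by
      have : r ∈ B.erase e := by rw [hBe']; exact mem_insert_self r _
      exact (mem_erase.1 this).2
    refine ⟨B.erase r, mem_partr.2 ⟨notMem_erase r B, by rw [insert_erase hrB]; exact hB⟩, ?_⟩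
    rw [erase_right_comm, hBe', erase_insert hrse]
  · -- `r` removable: orientation 10
    left
    intro t ht
    obtain ⟨hrt, htF⟩ := mem_partr.1 ht
    have h2 := h _ (mem_proj.2 ⟨insert r t, htF, rfl⟩)
    rw [sdiff_singleton_eq_erase, erase_right_comm, erase_insert hrt] at h2
    obtain ⟨B, hB, hBe⟩ := mem_proj.1 h2
    have hrB : r ∉ B := by
      intro hrB
      have : r ∈ B.erase e := mem_erase.2 ⟨hre.symm, hrB⟩
      rw [hBe] at this
      exact hrt (mem_erase.1 this).2
    exact ⟨B, mem_part0.2 ⟨hB, hrB⟩, hBe⟩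

end Orientation

section Argument

variable (hP : Tight (proj r F)) (htf : ∀ a b, Twin F a b → a = b) (hsupp : ∀ a, ∃ t ∈ F, a ∈ t)
include hP htf hsupp

/-- **Orientation 10 with `e` in no partnerless `r`-member gives `Y ⊆ X`.** -/
theorem diffsY_subset_diffsX_of_orientation10
    (h10 : ∀ t ∈ partr r F, ∃ s ∈ part0 r F, s.erase e = t.erase e)
    (hE : ∀ t ∈ partr r F, t ∉ part0 r F → e ∉ t) : diffsY r F ⊆ diffsX r F := by
  intro z hz
  obtain ⟨t, ht, s, hs, rfl⟩ := mem_diffs.1 hz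
  by_cases ht0 : t ∈ part0 r F
  · exact mem_union_left _ (mem_union_left _ (mem_diffs.2 ⟨t, ht0, s, hs, rfl⟩))
  · have het : e ∉ t := hE t ht ht0
    obtain ⟨s', hs', hse⟩ := h10 t ht
    rw [erase_eq_of_notMem het] at hse
    have hts' : t ⊆ s' := by
      rw [← hse]; exact erase_subset e s'
    exact sdiff_mem_diffsX_of_superset_mem_part0 hP (twinFree_proj_of_twinFree htf hsupp) hz hs'
      (sdiff_subset.trans hts')

/-- **Orientation 01 with `e` in every partnerless `r`-free member gives `Y ⊆ X`.** -/
theorem diffsY_subset_diffsX_of_orientation01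
    (h01 : ∀ s ∈ part0 r F, ∃ t ∈ partr r F, t.erase e = s.erase e)
    (hE : ∀ s ∈ part0 r F, s ∉ partr r F → e ∈ s) : diffsY r F ⊆ diffsX r F := by
  intro z hz
  obtain ⟨t, ht, s, hs, rfl⟩ := mem_diffs.1 hz
  by_cases hs1 : s ∈ partr r F
  · exact mem_union_left _ (mem_union_right _ (mem_diffs.2 ⟨t, ht, s, hs1, rfl⟩))
  · have hes : e ∈ s := hE s hs hs1
    obtain ⟨t', ht', hte⟩ := h01 s hs
    have hts : t' ⊆ s := by
      intro x hx
      by_cases hxe : x = e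
      · rw [hxe]; exact hes
      · have : x ∈ t'.erase e := mem_erase.2 ⟨hxe, hx⟩
        rw [hte] at this
        exact (mem_erase.1 this).2
    exact sdiff_mem_diffsX_of_disjoint_mem_partr hP (twinFree_proj_of_twinFree htf hsupp) hz ht'
      (sdiff_disjoint.mono_right hts)

end Argument

section Good

/-- `e` is a **good second direction** for `(F, r)`: `e ≠ r`, the trace at `e` is tight, and `e` lies
in no partnerless `r`-member (with orientation 10) or in every partnerless `r`-free member (with
orientation 01). -/
def GoodDirectionAt (r e : α) (F : Finset (Finset α)) : Prop :=
  e ≠ r ∧ Tight (proj e F) ∧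
    (((∀ t ∈ partr r F, ∃ s ∈ part0 r F, s.erase e = t.erase e) ∧
        ∀ t ∈ partr r F, t ∉ part0 r F → e ∉ t) ∨
      ((∀ s ∈ part0 r F, ∃ t ∈ partr r F, t.erase e = s.erase e) ∧
        ∀ s ∈ part0 r F, s ∉ partr r F → e ∈ s))

/-- **`Y ⊆ X` from a good second direction.** -/
theorem diffsY_subset_diffsX_of_goodDirectionAt (hP : Tight (proj r F))
    (htf : ∀ a b, Twin F a b → a = b) (hsupp : ∀ a, ∃ t ∈ F, a ∈ t)
    (hg : GoodDirectionAt r e F) : diffsY r F ⊆ diffsX r F := by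
  rcases hg with ⟨-, -, ⟨h10, hE⟩ | ⟨h01, hE⟩⟩
  · exact diffsY_subset_diffsX_of_orientation10 hP htf hsupp h10 hE
  · exact diffsY_subset_diffsX_of_orientation01 hP htf hsupp h01 hE

/-- The orientation clause of a good direction is automatic from tightness: `e ≠ r` with a tight
trace at `e` is good as soon as `e` avoids every partnerless `r`-member AND lies in every
partnerless `r`-free member (whichever orientation Theorem S returns applies). -/
theorem goodDirectionAt_of_avoids_of_mem (hre : e ≠ r) (hG : Tight (proj e F))
    (htf : ∀ a b, Twin F a b → a = b) (hsupp : ∀ a, ∃ t ∈ F, a ∈ t)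
    (hE1 : ∀ t ∈ partr r F, t ∉ part0 r F → e ∉ t)
    (hE0 : ∀ s ∈ part0 r F, s ∉ partr r F → e ∈ s) : GoodDirectionAt r e F := by
  refine ⟨hre, hG, ?_⟩
  rcases orientation_of_tight_proj hre hG htf hsupp with h | h
  · exact Or.inl ⟨h, hE1⟩
  · exact Or.inr ⟨h, hE0⟩

end Good

section Candidate

variable (α)

/-- **The good-direction lemma (E), as a candidate Prop** (never asserted; Addendum 47): in a
residue instance `F` with a genuine tight trace at `r` (`{r}, univ ∖ r ∉ F`) and at least two
partnerless members on each side, some `e` is a good second direction. Census: 1,140 / 1,140 on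
the case-(β) residue configurations with `|P₀|, |P₁| ≥ 2` (the only open shape of Conjecture (T));
on singleton sides it can fail, and there MSTightConjTSingleton applies. -/
def GoodDirection : Prop :=
  ∀ (F : Finset (Finset α)) (u : Finset α) (r : α), Residue F u → Tight (proj r F) →
    ({r} : Finset α) ∉ F → univ.erase r ∉ F →
    (∃ s ∈ part0 r F, s ∉ partr r F ∧ ∃ s' ∈ part0 r F, s' ∉ partr r F ∧ s ≠ s') →
    (∃ t ∈ partr r F, t ∉ part0 r F ∧ ∃ t' ∈ partr r F, t' ∉ part0 r F ∧ t ≠ t') →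
    ∃ e, GoodDirectionAt r e F

variable {α}

omit [Fintype α] in
/-- The trace of a family with `∅, {r} ∉ F` avoids `∅`. -/
theorem empty_notMem_proj_of_genuine (hE : (∅ : Finset α) ∉ F) (hr : ({r} : Finset α) ∉ F) :
    (∅ : Finset α) ∉ proj r F := by
  intro h
  obtain ⟨B, hB, hBe⟩ := mem_proj.1 h
  by_cases hrB : r ∈ B
  · apply hr
    have : B = {r} := by
      ext x
      constructor
      · intro hx
        by_cases hxr : x = r
        · rw [hxr]; exact mem_singleton_self r
        · exact absurd (mem_erase.2 ⟨hxr, hx⟩) (by rw [hBe]; exact notMem_empty x)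
      · intro hx
        rw [mem_singleton.1 hx]; exact hrB
    rw [← this]; exact hB
  · apply hE
    rw [erase_eq_of_notMem hrB] at hBe
    rw [← hBe]; exact hB

/-- The trace of a family with `univ, univ ∖ r ∉ F` avoids `univ ∖ r`. -/
theorem univ_erase_notMem_proj_of_genuine (hU : (univ : Finset α) ∉ F)
    (hr : univ.erase r ∉ F) : univ.erase r ∉ proj r F := by
  intro h
  obtain ⟨B, hB, hBe⟩ := mem_proj.1 h
  by_cases hrB : r ∈ B
  · apply hU
    have : B = univ := by
      ext x
      refine ⟨fun _ => mem_univ x, fun _ => ?_⟩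
      by_cases hxr : x = r
      · rw [hxr]; exact hrB
      · have : x ∈ B.erase r := by rw [hBe]; exact mem_erase.2 ⟨hxr, mem_univ x⟩
        exact (mem_erase.1 this).2
    rw [← this]; exact hB
  · apply hr
    rw [erase_eq_of_notMem hrB] at hBe
    rw [← hBe]; exact hB

/-- **`Y ⊆ X` in a residue instance at a genuine tight trace, from `GoodDirection α`**: singleton
sides by MSTightConjTSingleton, both sides of size `≥ 2` by the good second direction. -/
theorem diffsY_subset_diffsX_of_goodDirection (hGD : GoodDirection α) {u : Finset α}
    (h : Residue F u) (hP : Tight (proj r F)) (hr1 : ({r} : Finset α) ∉ F)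
    (hr2 : univ.erase r ∉ F) : diffsY r F ⊆ diffsX r F := by
  have htfP : ∀ a b, Twin (proj r F) a b → a = b := twinFree_proj_of_twinFree h.htf h.hsupp
  by_cases hs2 : ∃ s ∈ part0 r F, s ∉ partr r F ∧ ∃ s' ∈ part0 r F, s' ∉ partr r F ∧ s ≠ s'
  · by_cases ht2 : ∃ t ∈ partr r F, t ∉ part0 r F ∧ ∃ t' ∈ partr r F, t' ∉ part0 r F ∧ t ≠ t'
    · obtain ⟨e, he⟩ := hGD F u r h hP hr1 hr2 hs2 ht2
      exact diffsY_subset_diffsX_of_goodDirectionAt hP h.htf h.hsupp he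
    · -- at most one partnerless `r`-member
      apply diffsY_subset_diffsX_of_partr_subsingleton hP htfP
      · intro a
        obtain ⟨t, htF, hat⟩ := h.hcore a
        exact ⟨t.erase r, mem_proj.2 ⟨t, htF, rfl⟩, fun h' => hat (mem_erase.1 h').2⟩
      · exact empty_notMem_proj_of_genuine h.hempty hr1
      · intro t ht ht0 t' ht' ht0'
        by_contra hne
        exact ht2 ⟨t, ht, ht0, t', ht', ht0', hne⟩
  · -- at most one partnerless `r`-free member
    apply diffsY_subset_diffsX_of_part0_subsingleton hP htfP
    · intro a _
      obtain ⟨t, htF, hat⟩ := h.hsupp a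
      -- `a ≠ r` is not needed: if `a = r` the goal still needs a member of the trace containing `a`;
      -- we use the hypothesis `a ≠ r` of the statement through `hat`
      exact ⟨t.erase r, mem_proj.2 ⟨t, htF, rfl⟩, mem_erase.2 ⟨‹a ≠ r›, hat⟩⟩
    · exact univ_erase_notMem_proj_of_genuine h.huniv hr2
    · intro s hs0 hs1 s' hs0' hs1'
      by_contra hne
      exact hs2 ⟨s, hs0, hs1, s', hs0', hs1', hne⟩

/-- **`SingNonMonotone α` from `GoodDirection α` and `SingCaseIResidue α`** — the lane's chain with
the good-direction lemma in place of `ConjT α`. -/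
theorem singNonMonotone_of_goodDirection_of_residue (hGD : GoodDirection α)
    (hR : SingCaseIResidue α) : SingNonMonotone α := by
  intro F u r h hP hru hu1 hrem hadd
  by_contra hcon
  push Not at hcon
  obtain ⟨hr1, hr2⟩ := hcon
  have hT : diffsY r F ⊆ diffsX r F := diffsY_subset_diffsX_of_goodDirection hGD h hP hr1 hr2
  obtain ⟨s, hs, hsY⟩ :=
    exists_part0_sdiff_notMem_diffsY_of_not_tight_insert h.hexc h.hu h.hnt hru hu1 hT
  exact hsY (hR F u r h hP hru hu1 hrem hadd hT hr1 hr2 s hs)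

end Candidate

end PercRepro.MSTight
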